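import Mathlib.Analysis.Matrix.Spectrum
import Mathlib.LinearAlgebra.Dimension.Constructions
import Mathlib.LinearAlgebra.Dimension.StrongRankCondition

/-!
# Chiral inertia for Hermitian matrices (negative-side toolkit for crux `ExtinctionBuildsQCD`,
# stmt-QuantumFields-8968)

One direction of Sylvester's law of inertia for Mathlib's eigenvalue enumeration
`Matrix.IsHermitian.eigenvalues` of a complex Hermitian matrix `A = U diag(λ) U†`
(`eigenvectorUnitary`), in the form needed to count negative roots of characteristic polynomials:

* `re_form_eq_sum_eigenvalues` — `Re⟨v, A v⟩ = Σ_i λ_i ‖(U† v)_i‖²`;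
* `card_le_card_eigenvalues_of_form_pos` — if `s · Re⟨Ec, A Ec⟩ > 0` for all `c ≠ 0` on the
  source `ι → ℂ` of a linear map `E`, then `card ι ≤ #{i | s λ_i > 0}` (the map
  `c ↦ (U† E c)|_{s λ > 0}` is injective);
* `countP_roots_charpoly_eq_card`, `countP_neg_eq_of_chiral` — two definite sectors of
  complementary dimensions determine the number of negative roots of `charpoly A` exactly.

Used by `Negative/TightPinsLine.lean` (the Hermitian Wilson operator `Γ₅ D_W(U, m₀, 1)` off the
Wilson hole). Reference: Horn–Johnson, *Matrix Analysis*, §4.5 (Sylvester's law of inertia).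
-/

namespace Summit.QuantumFields.QCD.Theorems.ExtinctionBuildsQCD.Negative

open scoped BigOperators Matrix ComplexConjugate
open Matrix

section Inertia

variable {n : Type*} [Fintype n] [DecidableEq n]

/-- **The Hermitian form in eigen-coordinates**: `Re⟨v, A v⟩ = Σ_i λ_i ‖(U† v)_i‖²` for a Hermitian
matrix `A = U diag(λ) U†` (Mathlib's `eigenvectorUnitary`). -/
theorem re_form_eq_sum_eigenvalues {A : Matrix n n ℂ} (hA : A.IsHermitian) (v : n → ℂ) :
    (star v ⬝ᵥ (A *ᵥ v)).re =
      ∑ i, hA.eigenvalues i * ‖((hA.eigenvectorUnitary : Matrix n n ℂ)ᴴ *ᵥ v) i‖ ^ 2 := by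
  set U : Matrix n n ℂ := (hA.eigenvectorUnitary : Matrix n n ℂ) with hUdef
  have hof : (RCLike.ofReal ∘ hA.eigenvalues : n → ℂ) = fun i => ((hA.eigenvalues i : ℝ) : ℂ) := rfl
  have hU : A = U * diagonal (fun i => ((hA.eigenvalues i : ℝ) : ℂ)) * Uᴴ := by
    have h := hA.spectral_theorem
    rw [Unitary.conjStarAlgAut_apply, star_eq_conjTranspose, hof] at h
    exact h
  set w := Uᴴ *ᵥ v with hw
  calc (star v ⬝ᵥ (A *ᵥ v)).re
      = (star v ⬝ᵥ ((U * diagonal (fun i => ((hA.eigenvalues i : ℝ) : ℂ)) * Uᴴ) *ᵥ v)).re := by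
        rw [← hU]
    _ = (star w ⬝ᵥ (diagonal (fun i => ((hA.eigenvalues i : ℝ) : ℂ)) *ᵥ w)).re := by
        rw [← mulVec_mulVec, ← mulVec_mulVec, dotProduct_mulVec, hw, star_mulVec,
          conjTranspose_conjTranspose]
    _ = ∑ i, hA.eigenvalues i * ‖w i‖ ^ 2 := by
        rw [dotProduct, Complex.re_sum]
        refine Finset.sum_congr rfl fun i _ => ?_
        rw [mulVec_diagonal, Pi.star_apply, Complex.star_def]
        have : (starRingEnd ℂ) (w i) * (((hA.eigenvalues i : ℝ) : ℂ) * w i) =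
            ((hA.eigenvalues i : ℝ) : ℂ) * ((starRingEnd ℂ) (w i) * w i) := by ring
        rw [this, ← Complex.normSq_eq_conj_mul_self, Complex.re_ofReal_mul, Complex.ofReal_re,
          Complex.normSq_eq_norm_sq]

/-- **Inertia lower bound (Sylvester, one direction).** If the real quadratic form
`s · Re⟨v, A v⟩` of a Hermitian matrix `A` is positive on the image of a linear map `E` from
`ι → ℂ` (off `c = 0`), then `A` has at least `card ι` eigenvalues `λ` with `s λ > 0` (counted in
Mathlib's enumeration `hA.eigenvalues`). Proof: `c ↦ (U† E c)|_{s λ > 0}` is injective, since a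
kernel vector would have `s Re⟨Ec, A Ec⟩ = Σ_{s λ_i ≤ 0} s λ_i ‖(U†Ec)_i‖² ≤ 0`. -/
theorem card_le_card_eigenvalues_of_form_pos {A : Matrix n n ℂ} (hA : A.IsHermitian) (s : ℝ)
    {ι : Type*} [Fintype ι] (E : (ι → ℂ) →ₗ[ℂ] (n → ℂ))
    (hpos : ∀ c : ι → ℂ, c ≠ 0 → 0 < s * (star (E c) ⬝ᵥ (A *ᵥ E c)).re) :
    Fintype.card ι ≤ (Finset.univ.filter fun i => 0 < s * hA.eigenvalues i).card := by
  set U : Matrix n n ℂ := (hA.eigenvectorUnitary : Matrix n n ℂ) with hUdef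
  let P : Type _ := {i : n // 0 < s * hA.eigenvalues i}
  -- the comparison map `c ↦ (U† E c)|_P`
  let φ : (ι → ℂ) →ₗ[ℂ] (P → ℂ) :=
    (LinearMap.funLeft ℂ ℂ (Subtype.val : P → n)) ∘ₗ (Matrix.mulVecLin Uᴴ) ∘ₗ E
  have hφ : ∀ c, φ c = fun i : P => (Uᴴ *ᵥ E c) i.val := fun c => rfl
  have hinj : Function.Injective φ := by
    rw [← LinearMap.ker_eq_bot, LinearMap.ker_eq_bot']
    intro c hc
    by_contra hc0
    have hlt := hpos c hc0
    have hzero : ∀ i : n, 0 < s * hA.eigenvalues i → (Uᴴ *ᵥ E c) i = 0 := fun i hi => by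
      have := congrFun (hφ c ▸ hc) ⟨i, hi⟩
      simpa using this
    have hle : s * (star (E c) ⬝ᵥ (A *ᵥ E c)).re ≤ 0 := by
      rw [re_form_eq_sum_eigenvalues hA (E c), Finset.mul_sum]
      refine Finset.sum_nonpos fun i _ => ?_
      by_cases hi : 0 < s * hA.eigenvalues i
      · rw [hzero i hi, norm_zero]; simp
      · push Not at hi
        have : 0 ≤ ‖((hA.eigenvectorUnitary : Matrix n n ℂ)ᴴ *ᵥ E c) i‖ ^ 2 := by positivity
        nlinarith
    linarith
  have h := LinearMap.finrank_le_finrank_of_injective hinj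
  rw [Module.finrank_pi, Module.finrank_pi] at h
  simpa [P, Fintype.card_subtype] using h

/-- Counting roots of the characteristic polynomial of a Hermitian matrix through Mathlib's
eigenvalue enumeration. -/
theorem countP_roots_charpoly_eq_card {A : Matrix n n ℂ} (hA : A.IsHermitian) (p : ℂ → Prop)
    [DecidablePred p] :
    A.charpoly.roots.countP p =
      (Finset.univ.filter fun i => p ((hA.eigenvalues i : ℝ) : ℂ)).card := by
  rw [hA.roots_charpoly_eq_eigenvalues, Multiset.countP_map, Finset.card_def, Finset.filter_val]
  rfl

/-- **Chiral inertia.** If a Hermitian `A` has `s Re⟨v,Av⟩ > 0` on the image of `Ep` and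
`< 0` on the image of `Em`, with `card ιp + card ιm = card n`, then `A` has exactly `card ιm`
eigenvalues with `s λ < 0` (as roots of the characteristic polynomial, with multiplicity) — and no
zero eigenvalue. -/
theorem countP_neg_eq_of_chiral {A : Matrix n n ℂ} (hA : A.IsHermitian)
    {ιp ιm : Type*} [Fintype ιp] [Fintype ιm]
    (Ep : (ιp → ℂ) →ₗ[ℂ] (n → ℂ)) (Em : (ιm → ℂ) →ₗ[ℂ] (n → ℂ))
    (hpos : ∀ c : ιp → ℂ, c ≠ 0 → 0 < (star (Ep c) ⬝ᵥ (A *ᵥ Ep c)).re)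
    (hneg : ∀ c : ιm → ℂ, c ≠ 0 → (star (Em c) ⬝ᵥ (A *ᵥ Em c)).re < 0)
    (hcard : Fintype.card ιp + Fintype.card ιm = Fintype.card n) :
    A.charpoly.roots.countP (fun z => z.re < 0) = Fintype.card ιm := by
  have hp := card_le_card_eigenvalues_of_form_pos hA 1 Ep (fun c hc => by simpa using hpos c hc)
  have hm := card_le_card_eigenvalues_of_form_pos hA (-1) Em
    (fun c hc => by have := hneg c hc; linarith)
  simp only [one_mul] at hp
  simp only [neg_mul, one_mul, Left.neg_pos_iff] at hm
  -- the two eigenvalue sets are disjoint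
  have hdisj : Disjoint (Finset.univ.filter fun i => 0 < hA.eigenvalues i)
      (Finset.univ.filter fun i => hA.eigenvalues i < 0) := by
    rw [Finset.disjoint_filter]
    intro i _ h1 h2
    linarith
  have hunion : ((Finset.univ.filter fun i => 0 < hA.eigenvalues i) ∪
      (Finset.univ.filter fun i => hA.eigenvalues i < 0)).card ≤ Fintype.card n :=
    Finset.card_le_univ _
  rw [Finset.card_union_of_disjoint hdisj] at hunion
  rw [countP_roots_charpoly_eq_card hA]
  have : (Finset.univ.filter fun i => ((hA.eigenvalues i : ℝ) : ℂ).re < 0) =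
      (Finset.univ.filter fun i => hA.eigenvalues i < 0) := by
    simp only [Complex.ofReal_re]
  rw [this]
  omega

end Inertia

end Summit.QuantumFields.QCD.Theorems.ExtinctionBuildsQCD.Negative
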